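import Mathlib
import Summits.NavierStokesRegularity.NavierStokesRegularity.Theorems.RootDecompLitSliceEnergyClockScarLaw
import Summits.NavierStokesRegularity.NavierStokesRegularity.Theorems.QuarterJoltEnergyJumpDefect
import Summits.NavierStokesRegularity.NavierStokesRegularity.Theorems.CertifiedBlowupCertifiedBlowupAxisymBlowupBKM
import Summits.NavierStokesRegularity.NavierStokesRegularity.Theses.HalfHolderEnergy
import Literature.Analysis.FluidPDE.BKMClassGradientContinuity
import HarnessLib

/-!
# Route RootDecompLitSlice — cell Uᶜ `CritTameScarIsCritical` (stmt-NavierStokesRegularity-31733):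
# under tameness the ENERGY exponent IS the DISSIPATION exponent; kernel edges
# Uᶜ ⟸ `EnergyHalfHolder` (route HalfHolderEnergy) and Uᶜ ⟸ `EnstrophyQuarterLaw` (route QuarterJolt)

Helpers toward Uᶜ (`--supports 31733`, no item). In Uᶜ's frame the solution is `L²`-TAME at `T`
(`u(t) → u(T)` in `L²`), and by the QuarterJolt kernel (`NoTerminalJolt.tendsto_eLpNorm_sub_iff_energyEquality`,
`NoTerminalJolt.energyEq_before`) tameness is EQUIVALENT to Leray's energy equality on `[0,T]`. Hence

* `energyDrop_eq_dissipation_of_tame` — for a classical solution on `[0,T)`, Leray–Hopf on `[0,T]`,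
  tame at `T`: `‖u(t)‖₂² − ‖u(T)‖₂² = 2ν ∫_t^T ∫ |∇u|²_F` EXACTLY for every `t ∈ [0,T)` (no energy
  jump). So the energy exponent `a` of the energy–clock rectangle (datum η) is literally the exponent of
  the WINDOW DISSIPATION `∫_t^T‖∇u‖₂²`, and the ½-Hölder corner of Uᶜ (`halfHolderClockCell`) reads
  «`∫_t^T‖∇u‖₂² ≤ C√(T−t)`» = Leray-sharp dissipation («H¹-mean Type I»):
  `criticalScar_of_clock_of_dissipationHalfLaw`.
* `critTameScarIsCritical_of_energyHalfHolder` — the INTER-ROUTE EDGE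
  `Theses.HalfHolderEnergy.EnergyHalfHolder → Theses.RootDecompLitSlice.CritTameScarIsCritical`:
  the window quarter law `∫_a^b∫|curl u|² ≤ K√(b−a)` (crux ⟨25161⟩, rank 2 of route HalfHolderEnergy,
  Tao-loaded) makes the dissipation ½-Hölder at `T` (`∫|∇u(τ)|²_F = ∫|curl u(τ)|²` slice-wise on
  `[0,T)`, `lintegral_frobeniusNormSq_fderiv_eq_lintegral_curl_sq` in Tao's slab class), hence Uᶜ.
* `critTameScarIsCritical_of_enstrophyQuarterLaw` — the INTER-ROUTE EDGE
  `Theses.QuarterJolt.EnstrophyQuarterLaw → Theses.RootDecompLitSlice.CritTameScarIsCritical`: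
  «enstrophy blows up at most at Leray's rate» `∫|curl u(t)|² ≤ K/√(T−t)` (crux of route QuarterJolt,
  `H¹`-Type I) integrates to the window law with constant `2K`.

So in the partial order of open statements: `EnstrophyQuarterLaw ⟹ (windowed) EnergyHalfHolder-at-T ⟹ Uᶜ`,
all Tao-relevant only through Uᶜ's Tao-vacuity (both hypotheses are Tao-LOADED as pieces; Uᶜ assumes
the critical clock instead and is Tao-vacuous).

HONEST FRAMING: helpers/edges INSIDE the Tao-vacuous cell Uᶜ; no item, no node, no load of any route
moves (ROOT ⟺ U ∧ P1, critic rows 354/371/563/639). Rung 0: nothing here proves NS regularity.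
Decomp-ns route-writer g36. [folklore]
-/

set_option linter.dupNamespace false

namespace Summit.NavierStokesRegularity.NavierStokesRegularity.Theorems

open MeasureTheory Set Filter Topology
open scoped ENNReal
open Literature.Analysis.FluidPDE

namespace EnergyClockScarLaw

/-- Splitting the dissipation integral at `t ∈ [0,T)`: `∫₀ᵀ = ∫₀ᵗ + ∫ₜᵀ` (open intervals; the point
`t` is Lebesgue-null). [folklore] -/
theorem lintegral_Ioo_split (F : ℝ → ℝ≥0∞) {t T : ℝ} (ht0 : 0 ≤ t) (htT : t ≤ T) :
    (∫⁻ τ in Ioo 0 T, F τ) = (∫⁻ τ in Ioo 0 t, F τ) + ∫⁻ τ in Ioo t T, F τ := by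
  rcases ht0.eq_or_lt with h0 | h0
  · subst h0; simp
  · rw [← Ioo_union_Ico_eq_Ioo h0 htT, lintegral_union measurableSet_Ico
      (Set.disjoint_left.2 fun x hx hx' => (not_lt.2 hx'.1) hx.2),
      setLIntegral_congr (Ioo_ae_eq_Ico (μ := (volume : Measure ℝ)) (a := t) (b := T))]

/-- **Under tameness the energy drop IS the window dissipation.** For a classical solution of unforced
Navier–Stokes on `ℝ³ × [0,T)` (`ν > 0`, `T > 0`), Leray–Hopf on `[0,T]` from `u 0` and `L²`-tame at `T`
(`u(t) → u(T)` in `L²`): `∫|u(t)|² − ∫|u(T)|² = 2ν ∫_t^T ∫ |∇u|²_F` for every `t ∈ [0,T)` (Leray's energy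
equality holds up to and including `T`: no energy jump; QuarterJolt kernel
`NoTerminalJolt.tendsto_eLpNorm_sub_iff_energyEquality` + `energyEq_before`). [folklore] -/
theorem energyDrop_eq_dissipation_of_tame {ν T : ℝ} (hν : 0 < ν) (hT : 0 < T)
    {u : ℝ → EuclideanSpace ℝ (Fin 3) → EuclideanSpace ℝ (Fin 3)}
    {p : ℝ → EuclideanSpace ℝ (Fin 3) → ℝ}
    (hcl : IsClassicalNSSolutionOn (Ico 0 T) ν 0 u p) (hLH : IsLerayHopfOn T ν 0 (u 0) u)
    (htame : Tendsto (fun t => eLpNorm (u t - u T) 2 volume) (𝓝[<] T) (𝓝 0))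
    {t : ℝ} (ht : t ∈ Ico 0 T) :
    (∫ x, ‖u t x‖ ^ 2) - ∫ x, ‖u T x‖ ^ 2 =
      2 * ν * (∫⁻ τ in Ioo t T, ∫⁻ x, ENNReal.ofReal (frobeniusNormSq (fderiv ℝ (u τ) x))).toReal := by
  set F : ℝ → ℝ≥0∞ := fun τ => ∫⁻ x, ENNReal.ofReal (frobeniusNormSq (fderiv ℝ (u τ) x)) with hF
  have hET := (NoTerminalJolt.tendsto_eLpNorm_sub_iff_energyEquality hν hT hcl hLH).1 htame
  have hEt := NoTerminalJolt.energyEq_before hν hcl hLH le_rfl ht.1 ht.2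
  have hfin1 : (∫⁻ τ in Ioo 0 t, F τ) ≠ ⊤ :=
    (CertifiedBlowupAxisymBlowup.EnergyDrain.dissipation_le_energy_sub hν hcl hLH le_rfl ht.1
      ht.2.le).1
  have hfin2 : (∫⁻ τ in Ioo t T, F τ) ≠ ⊤ :=
    (CertifiedBlowupAxisymBlowup.EnergyDrain.dissipation_le_energy_sub hν hcl hLH ht.1 ht.2.le
      le_rfl).1
  have hsplit : (∫⁻ τ in Ioo 0 T, F τ).toReal =
      (∫⁻ τ in Ioo 0 t, F τ).toReal + (∫⁻ τ in Ioo t T, F τ).toReal := by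
    rw [lintegral_Ioo_split F ht.1 ht.2.le, ENNReal.toReal_add hfin1 hfin2]
  have hKE : ∀ v : EuclideanSpace ℝ (Fin 3) → EuclideanSpace ℝ (Fin 3),
      VectorCalculus.kineticEnergy v = 2⁻¹ * ∫ x, ‖v x‖ ^ 2 := fun v => by
    simp only [VectorCalculus.kineticEnergy]
  rw [hKE, hKE] at hET; rw [hKE, hKE] at hEt
  rw [hsplit] at hET
  linarith

/-- **The ½-Hölder corner of Uᶜ in DISSIPATION currency** («H¹-mean Type I on the critical clock»): on
Uᶜ's frame (maximal smooth solution, Leray–Hopf on `[0,T]`, rapidly decaying datum, tame at `T`,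
critical clock), Leray-sharp window dissipation `∫_t^T∫|∇u|²_F ≤ C√(T−t)` near `T` gives critical
scars — `halfHolderClockCell` with the energy law supplied by `energyDrop_eq_dissipation_of_tame`.
[folklore] -/
theorem criticalScar_of_clock_of_dissipationHalfLaw :
    ∀ (ν T : ℝ), 0 < ν → 0 < T →
    ∀ (u : ℝ → EuclideanSpace ℝ (Fin 3) → EuclideanSpace ℝ (Fin 3))
      (p : ℝ → EuclideanSpace ℝ (Fin 3) → ℝ),
      IsMaximalSmoothSolution ν 0 u p T →
      IsLerayHopfOn T ν 0 (u 0) u →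
      HasRapidSpatialDecay (u 0) →
      Tendsto (fun t => eLpNorm (u t - u T) 2 volume) (𝓝[<] T) (𝓝 0) →
      (∃ K T₁ : ℝ, T₁ < T ∧ ∀ t ∈ Ioo T₁ T,
        ∫⁻ x, ‖u t x - u T x‖ₑ ^ 2 ≤ ENNReal.ofReal (K * Real.sqrt (T - t))) →
      (∃ C T₂ : ℝ, T₂ < T ∧ ∀ t ∈ Ioo T₂ T, 0 ≤ t →
        (∫⁻ τ in Ioo t T, ∫⁻ x, ENNReal.ofReal (frobeniusNormSq (fderiv ℝ (u τ) x))).toReal ≤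
          C * Real.sqrt (T - t)) →
      ∀ x₀ : EuclideanSpace ℝ (Fin 3), ∃ M r₁ : ℝ, 0 < r₁ ∧ ∀ r ∈ Ioo 0 r₁,
        r⁻¹ * ∫ x in Metric.ball x₀ r, ‖u T x‖ ^ 2 ≤ M := by
  intro ν T hν hT u p hmax hLH hdec htame hclock hdiss x₀
  obtain ⟨C, T₂, hT₂, hC⟩ := hdiss
  refine halfHolderClockCell ν T hν hT u p hmax hLH hdec htame hclock
    ⟨2 * ν * max C 0, max T₂ 0, max_lt hT₂ hT, fun t ht => ?_⟩ x₀
  have ht0 : 0 ≤ t := (le_max_right _ _).trans ht.1.le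
  have ht₂ : T₂ < t := lt_of_le_of_lt (le_max_left _ _) ht.1
  rw [energyDrop_eq_dissipation_of_tame hν hT hmax.1 hLH htame ⟨ht0, ht.2⟩]
  have h1 := hC t ⟨ht₂, ht.2⟩ ht0
  have h2 : C * Real.sqrt (T - t) ≤ max C 0 * Real.sqrt (T - t) :=
    mul_le_mul_of_nonneg_right (le_max_left _ _) (Real.sqrt_nonneg _)
  have h3 := h1.trans h2
  have hν2 : 0 ≤ 2 * ν := by positivity
  calc 2 * ν * (∫⁻ τ in Ioo t T, ∫⁻ x, ENNReal.ofReal (frobeniusNormSq (fderiv ℝ (u τ) x))).toReal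
      ≤ 2 * ν * (max C 0 * Real.sqrt (T - t)) := mul_le_mul_of_nonneg_left h3 hν2
    _ = 2 * ν * max C 0 * Real.sqrt (T - t) := by ring

/-- Slice identity `∫⁻ |∇u(τ)|²_F = ∫⁻ ‖curl u(τ)‖ₑ²` on `[0,T)` for a classical Leray–Hopf solution from
a rapidly decaying datum (Tao's slab class: all `L²` Sobolev norms bounded on `[0,T'']`, `T'' < T`).
[cite: DoeringGibbon1995, §1.4 eq. (1.4.20)–(1.4.21)] -/
theorem lintegral_frobeniusNormSq_eq_lintegral_curl_sq_of_frame {ν T : ℝ} (hν : 0 < ν) (hT : 0 < T)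
    {u : ℝ → EuclideanSpace ℝ (Fin 3) → EuclideanSpace ℝ (Fin 3)}
    {p : ℝ → EuclideanSpace ℝ (Fin 3) → ℝ}
    (hcl : IsClassicalNSSolutionOn (Ico 0 T) ν 0 u p) (hLH : IsLerayHopfOn T ν 0 (u 0) u)
    (hdec : HasRapidSpatialDecay (u 0)) {τ : ℝ} (hτ : τ ∈ Ico 0 T) :
    (∫⁻ x, ENNReal.ofReal (frobeniusNormSq (fderiv ℝ (u τ) x))) = ∫⁻ x, ‖curl (u τ) x‖ₑ ^ 2 := by
  have hreg := CertifiedBlowupAxisymBlowup.CompactAmplification.hasBoundedSobolevNormsOn_before_of_lerayHopf_classical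
    hν hT hcl hLH hdec
  have hsm : ContDiff ℝ 2 (u τ) := (hcl.contDiff_velocity hτ).of_le (by norm_cast)
  have hn : ∀ n : ℕ, ∫⁻ x, ‖iteratedFDeriv ℝ n (u τ) x‖ₑ ^ 2 < ⊤ := fun n => by
    obtain ⟨C, hC⟩ := hreg τ hτ.2 n
    exact (hC τ ⟨hτ.1, le_rfl⟩).trans_lt ENNReal.coe_lt_top
  have h0 : ∫⁻ x, ‖u τ x‖ₑ ^ 2 < ⊤ := by
    refine lt_of_le_of_lt (le_of_eq (lintegral_congr fun x => ?_)) (hn 0)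
    rw [← ofReal_norm, ← norm_iteratedFDeriv_zero (𝕜 := ℝ) (f := u τ), ofReal_norm]
  exact lintegral_frobeniusNormSq_fderiv_eq_lintegral_curl_sq hsm (hcl.divFree τ hτ) h0 (hn 1) (hn 2)

/-- **Window dissipation in vorticity currency**: on the frame, for `0 ≤ t < T`,
`∫_t^T ∫⁻|∇u|²_F = ∫_t^T ∫⁻‖curl u‖ₑ²`. [cite: DoeringGibbon1995, §1.4 eq. (1.4.20)–(1.4.21)] -/
theorem windowDissipation_eq_windowEnstrophy {ν T : ℝ} (hν : 0 < ν) (hT : 0 < T)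
    {u : ℝ → EuclideanSpace ℝ (Fin 3) → EuclideanSpace ℝ (Fin 3)}
    {p : ℝ → EuclideanSpace ℝ (Fin 3) → ℝ}
    (hcl : IsClassicalNSSolutionOn (Ico 0 T) ν 0 u p) (hLH : IsLerayHopfOn T ν 0 (u 0) u)
    (hdec : HasRapidSpatialDecay (u 0)) {t : ℝ} (ht : t ∈ Ico 0 T) :
    (∫⁻ τ in Ioo t T, ∫⁻ x, ENNReal.ofReal (frobeniusNormSq (fderiv ℝ (u τ) x))) =
      ∫⁻ τ in Ioo t T, ∫⁻ x, ‖curl (u τ) x‖ₑ ^ 2 :=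
  setLIntegral_congr_fun measurableSet_Ioo fun _ hτ =>
    lintegral_frobeniusNormSq_eq_lintegral_curl_sq_of_frame hν hT hcl hLH hdec ⟨ht.1.trans hτ.1.le, hτ.2⟩

/-- **INTER-ROUTE EDGE Uᶜ ⟸ EnergyHalfHolder.** The window quarter law of route HalfHolderEnergy
(crux `EnergyHalfHolder`, stmt-NavierStokesRegularity-25161: `∫_a^b∫|curl u|² ≤ K√(b−a)` for all
`0 ≤ a ≤ b ≤ T` at a first blow-up) implies the cell Uᶜ `CritTameScarIsCritical` of route
RootDecompLitSlice: it makes the window dissipation ½-Hölder at `T`, and the ½-Hölder corner of Uᶜ is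
the theorem `halfHolderClockCell`. (EnergyHalfHolder is Tao-LOADED as a piece; Uᶜ is Tao-vacuous —
the edge is a comparison in the partial order of open statements, not a load move.) [folklore] -/
theorem critTameScarIsCritical_of_energyHalfHolder
    (h : Summit.NavierStokesRegularity.NavierStokesRegularity.Theses.HalfHolderEnergy.EnergyHalfHolder) :
    Summit.NavierStokesRegularity.NavierStokesRegularity.Theses.RootDecompLitSlice.CritTameScarIsCritical := by
  intro ν T hν hT u p hmax hLH hdec htame hclock x₀
  obtain ⟨K, hK⟩ := h ν T hν hT u p hmax hLH hdec
  refine criticalScar_of_clock_of_dissipationHalfLaw ν T hν hT u p hmax hLH hdec htame hclock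
    ⟨max K 0, 0, hT, fun t ht ht0 => ?_⟩ x₀
  have htI : t ∈ Ico 0 T := ⟨ht0, ht.2⟩
  rw [windowDissipation_eq_windowEnstrophy hν hT hmax.1 hLH hdec htI]
  have hb := hK t T ht0 ht.2.le le_rfl
  have hnn : 0 ≤ max K 0 * Real.sqrt (T - t) := mul_nonneg (le_max_right _ _) (Real.sqrt_nonneg _)
  have hb' : (∫⁻ τ in Ioo t T, ∫⁻ x, ‖curl (u τ) x‖ₑ ^ 2) ≤ ENNReal.ofReal (max K 0 * Real.sqrt (T - t)) :=
    hb.trans (ENNReal.ofReal_le_ofReal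
      (mul_le_mul_of_nonneg_right (le_max_left _ _) (Real.sqrt_nonneg _)))
  exact (ENNReal.toReal_mono ENNReal.ofReal_ne_top hb').trans (le_of_eq (ENNReal.toReal_ofReal hnn))

/-- **INTER-ROUTE EDGE Uᶜ ⟸ EnstrophyQuarterLaw.** «Enstrophy blows up at most at Leray's rate»
(`∫|curl u(t)|² ≤ K/√(T−t)` on `[0,T)` at a first blow-up — crux `EnstrophyQuarterLaw` of route
QuarterJolt, `H¹`-Type I) implies the cell Uᶜ: integrating, `∫_t^T∫|curl u|² ≤ 2K√(T−t)`.
[folklore] -/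
theorem critTameScarIsCritical_of_enstrophyQuarterLaw
    (h : Summit.NavierStokesRegularity.NavierStokesRegularity.Theses.QuarterJolt.EnstrophyQuarterLaw) :
    Summit.NavierStokesRegularity.NavierStokesRegularity.Theses.RootDecompLitSlice.CritTameScarIsCritical := by
  intro ν T hν hT u p hmax hLH hdec htame hclock x₀
  obtain ⟨K, hK⟩ := h ν T hν hT u p hmax hLH hdec
  refine criticalScar_of_clock_of_dissipationHalfLaw ν T hν hT u p hmax hLH hdec htame hclock
    ⟨2 * max K 0, 0, hT, fun t ht ht0 => ?_⟩ x₀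
  have htI : t ∈ Ico 0 T := ⟨ht0, ht.2⟩
  rw [windowDissipation_eq_windowEnstrophy hν hT hmax.1 hLH hdec htI]
  -- pointwise bound on `(t,T)`: `∫⁻‖curl u τ‖ₑ² ≤ ofReal (max K 0 / √(T−τ))`
  have hpt : ∀ τ ∈ Ioo t T, (∫⁻ x, ‖curl (u τ) x‖ₑ ^ 2) ≤
      ENNReal.ofReal (max K 0 * (T - τ) ^ (-(1 / 2 : ℝ))) := fun τ hτ => by
    have hTτ : 0 < T - τ := sub_pos.mpr hτ.2
    refine (hK τ ⟨ht0.trans hτ.1.le, hτ.2⟩).trans (ENNReal.ofReal_le_ofReal ?_)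
    rw [Real.rpow_neg hTτ.le, ← Real.sqrt_eq_rpow, ← div_eq_mul_inv]
    exact div_le_div_of_nonneg_right (le_max_left _ _) (Real.sqrt_nonneg _)
  -- integrate the majorant: `∫_t^T (T−τ)^{-1/2} dτ = 2√(T−t)`
  have hTt : 0 < T - t := sub_pos.mpr ht.2
  have hmaj : (∫⁻ τ in Ioo t T, ENNReal.ofReal (max K 0 * (T - τ) ^ (-(1 / 2 : ℝ)))) =
      ENNReal.ofReal (2 * max K 0 * Real.sqrt (T - t)) := by
    have hint : IntervalIntegrable (fun τ : ℝ => max K 0 * (T - τ) ^ (-(1 / 2 : ℝ))) volume t T := by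
      refine (IntervalIntegrable.const_mul ?_ (max K 0))
      have h := (intervalIntegral.intervalIntegrable_rpow' (a := 0) (b := T - t)
        (r := -(1 / 2 : ℝ)) (by norm_num))
      -- `τ ↦ (T - τ)^r` on `[t,T]` is the reflection of `s ↦ s^r` on `[0, T-t]`
      have h2 := (h.comp_sub_left T)
      simpa using h2.symm
    have hnn : ∀ᵐ τ ∂(volume.restrict (Ioo t T)), 0 ≤ max K 0 * (T - τ) ^ (-(1 / 2 : ℝ)) := by
      refine (ae_restrict_iff' measurableSet_Ioo).2 (ae_of_all _ fun τ hτ => ?_)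
      exact mul_nonneg (le_max_right _ _) (Real.rpow_nonneg (sub_pos.mpr hτ.2).le _)
    have hintOn : IntegrableOn (fun τ : ℝ => max K 0 * (T - τ) ^ (-(1 / 2 : ℝ))) (Ioo t T) volume :=
      hint.1.mono_set Ioo_subset_Ioc_self
    rw [← ofReal_integral_eq_lintegral_ofReal hintOn hnn]
    congr 1
    rw [← integral_Ioc_eq_integral_Ioo, ← intervalIntegral.integral_of_le ht.2.le,
      intervalIntegral.integral_const_mul, intervalIntegral.integral_comp_sub_left
        (fun s : ℝ => s ^ (-(1 / 2 : ℝ))), sub_self, integral_rpow (Or.inl (by norm_num))]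
    rw [Real.sqrt_eq_rpow]
    norm_num
    ring
  have hle : (∫⁻ τ in Ioo t T, ∫⁻ x, ‖curl (u τ) x‖ₑ ^ 2) ≤
      ENNReal.ofReal (2 * max K 0 * Real.sqrt (T - t)) := by
    rw [← hmaj]; exact setLIntegral_mono' measurableSet_Ioo hpt
  have hnn' : 0 ≤ 2 * max K 0 * Real.sqrt (T - t) := by positivity
  exact (ENNReal.toReal_mono ENNReal.ofReal_ne_top hle).trans (le_of_eq (ENNReal.toReal_ofReal hnn'))

end EnergyClockScarLaw

end Summit.NavierStokesRegularity.NavierStokesRegularity.Theorems
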